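import Mathlib
import Literature.Probability.Process.PointStationaryLaw
import Literature.Probability.Process.PointStationaryTransfer
import Literature.Probability.Process.RootedHardCoreConfig
import Literature.MathematicalPhysics.StatisticalMechanics.BarlowStacking
import Literature.MathematicalPhysics.StatisticalMechanics.HaggStacking
import Summits.AtomisticToContinuum.Crystallization.Theorems.ChartedPlanarOrderBondWalkTransport
import Summits.AtomisticToContinuum.Crystallization.Theorems.ChartedPlanarOrderPatternFirstShellB

/-!
# Bond-walk transport for exactly patterned laws: the engine's hypotheses discharged

`ChartedPlanarOrderBondWalkTransport.lintegral_confWalk_iterate` (exact `n`-step bond random walk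
transport under a point-stationary law) asks for (a) local finiteness of a.e. configuration and
(b) a.s. constant root degree `μ B = d`. For ROOTED `δ`-hard-core laws (a) holds
(`ae_floorNorm_lt_top_of_rooted`), and for laws carried by flexible-gap Barlow patterns
(`b ∈ [9/10,1]`, any isometry, any Hägg sequence, admissible heights) the root has exactly `12`
bond-neighbours `0 < dist 0 y ≤ 28/25` (`ae_shell_eq_twelve_of_pattern`, from
`ChartedPlanarOrderPatternFirstShellB.firstShell_count_eq_twelve`). Hence the `ℝ≥0∞` form of the
V-line transport stub `stub_walkTransport` (lens-3, `ChartedPlanarOrder.ChartedZeroExcessLayered`,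
helper line «walk-squeeze»): `∫⁻ (W_μ^n F∘shift)(0) dP = ∫⁻ F dP` with the 12-regular bond walk
`W_μ h (x) = 12⁻¹ Σ_{0 < dist x y ≤ 28/25} h y` (`lintegral_bondWalk_iterate_of_pattern`). What is
left for the real-valued stub is the `ℝ ↔ ℝ≥0∞` bookkeeping of the Lennard-Jones site energy.
-/

namespace Summit.AtomisticToContinuum.Crystallization.Theorems.ChartedPlanarOrderPatternWalkHyps

open MeasureTheory Literature.MathematicalPhysics.StatisticalMechanics Literature.Probability.Process
open Summit.AtomisticToContinuum.Crystallization.Theorems.ChartedPlanarOrderPatternFirstShellB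
open Summit.AtomisticToContinuum.Crystallization.Theorems.ChartedPlanarOrderBondWalkTransport
open scoped ENNReal

/-- LOCAL FINITENESS: a law carried by rooted `δ`-separated counting measures (`δ > 0`) gives
finite mass to every norm shell `{⌊‖z‖⌋₊ = n}` almost surely. -/
theorem ae_floorNorm_lt_top_of_rooted {δ : ℝ} (hδ : 0 < δ)
    {P : Measure (Measure (EuclideanSpace ℝ (Fin 3)))}
    (hroot : ∀ᵐ μ ∂P, ∃ S : Set (EuclideanSpace ℝ (Fin 3)), (0 : EuclideanSpace ℝ (Fin 3)) ∈ S ∧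
      (∀ x ∈ S, ∀ y ∈ S, x ≠ y → δ ≤ dist x y) ∧
      μ = (Measure.count : Measure (EuclideanSpace ℝ (Fin 3))).restrict S) :
    ∀ᵐ μ ∂P, ∀ n : ℕ, μ ((fun z : EuclideanSpace ℝ (Fin 3) => ⌊‖z‖⌋₊) ⁻¹' {n}) < ∞ := by
  filter_upwards [hroot] with μ hμ n
  obtain ⟨S, -, hsep, rfl⟩ := hμ
  rw [Measure.restrict_apply (measurableSet_floorNorm_preimage n)]
  refine Measure.count_apply_lt_top.2 ?_
  refine (LocalConfig.finite_inter_of_separated hδ hsep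
    (isCompact_closedBall (0 : EuclideanSpace ℝ (Fin 3)) ((n : ℝ) + 1))).subset ?_
  exact Set.inter_subset_inter_left _ (floorNorm_preimage_subset_closedBall n)

/-- ROOT DEGREE 12: a law carried by rooted counting measures whose support is (exactly) a
flexible-gap Barlow pattern through the root has a.s. exactly `12` bond-neighbours of the root. -/
theorem ae_shell_eq_twelve_of_pattern {δ : ℝ} {P : Measure (Measure (EuclideanSpace ℝ (Fin 3)))}
    (hroot : ∀ᵐ μ ∂P, ∃ S : Set (EuclideanSpace ℝ (Fin 3)), (0 : EuclideanSpace ℝ (Fin 3)) ∈ S ∧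
      (∀ x ∈ S, ∀ y ∈ S, x ≠ y → δ ≤ dist x y) ∧
      μ = (Measure.count : Measure (EuclideanSpace ℝ (Fin 3))).restrict S)
    (hpat : ∀ᵐ μ ∂P, ∃ b : ℝ, 9 / 10 ≤ b ∧ b ≤ 1 ∧
      ∃ (A : EuclideanSpace ℝ (Fin 3) →ₗᵢ[ℝ] EuclideanSpace ℝ (Fin 3)) (s : ℤ → ℤ) (z : ℤ → ℝ),
        IsHaggSeq s ∧ (∀ m : ℤ, 39 / 50 * b ≤ z (m + 1) - z m ∧ z (m + 1) - z m ≤ 17 / 20 * b) ∧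
        z 0 = 0 ∧ ∀ y : EuclideanSpace ℝ (Fin 3), (μ {y} ≠ 0 ↔ y - (0 : EuclideanSpace ℝ (Fin 3)) ∈
          {p | ∃ m i j : ℤ, p = A (((i : ℝ) • triangularVec₁ b) + ((j : ℝ) • triangularVec₂ b) +
            ((haggLabel s m : ℝ) • barlowOffset b) + (z m • layerNormal 1))})) :
    ∀ᵐ μ ∂P, μ {y : EuclideanSpace ℝ (Fin 3) | 0 < dist (0 : EuclideanSpace ℝ (Fin 3)) y ∧
      dist (0 : EuclideanSpace ℝ (Fin 3)) y ≤ 28 / 25} = 12 := by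
  filter_upwards [hroot, hpat] with μ hμ hμ'
  obtain ⟨S, -, -, hS⟩ := hμ
  obtain ⟨b, hb1, hb2, A, s, z, hs, hz, hz0, hiff⟩ := hμ'
  have hSP : S = {p | ∃ m i j : ℤ, p = A (((i : ℝ) • triangularVec₁ b) + ((j : ℝ) • triangularVec₂ b) +
      ((haggLabel s m : ℝ) • barlowOffset b) + (z m • layerNormal 1))} := by
    ext y
    rw [← count_restrict_singleton_ne_zero_iff S y, ← hS, hiff y, sub_zero, Set.mem_setOf_eq]
  rw [hS, hSP]
  exact firstShell_count_eq_twelve b ⟨hb1, hb2⟩ A s hs z hz hz0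

/-- **Bond-walk transport for exactly patterned laws** (`ℝ≥0∞` form of the V-line stub
`stub_walkTransport`): for a point-stationary law of rooted hard-core configurations carried by
flexible-gap Barlow patterns, the `n`-step average of `F` over the 12-regular bond random walk
started at the root has the same `P`-mean as `F`, for every measurable `F ≥ 0` and every `n`. -/
theorem lintegral_bondWalk_iterate_of_pattern {δ : ℝ} (hδ : 0 < δ)
    {P : Measure (Measure (EuclideanSpace ℝ (Fin 3)))} (hP : IsPointStationaryLaw P)
    (hroot : ∀ᵐ μ ∂P, ∃ S : Set (EuclideanSpace ℝ (Fin 3)), (0 : EuclideanSpace ℝ (Fin 3)) ∈ S ∧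
      (∀ x ∈ S, ∀ y ∈ S, x ≠ y → δ ≤ dist x y) ∧
      μ = (Measure.count : Measure (EuclideanSpace ℝ (Fin 3))).restrict S)
    (hpat : ∀ᵐ μ ∂P, ∃ b : ℝ, 9 / 10 ≤ b ∧ b ≤ 1 ∧
      ∃ (A : EuclideanSpace ℝ (Fin 3) →ₗᵢ[ℝ] EuclideanSpace ℝ (Fin 3)) (s : ℤ → ℤ) (z : ℤ → ℝ),
        IsHaggSeq s ∧ (∀ m : ℤ, 39 / 50 * b ≤ z (m + 1) - z m ∧ z (m + 1) - z m ≤ 17 / 20 * b) ∧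
        z 0 = 0 ∧ ∀ y : EuclideanSpace ℝ (Fin 3), (μ {y} ≠ 0 ↔ y - (0 : EuclideanSpace ℝ (Fin 3)) ∈
          {p | ∃ m i j : ℤ, p = A (((i : ℝ) • triangularVec₁ b) + ((j : ℝ) • triangularVec₂ b) +
            ((haggLabel s m : ℝ) • barlowOffset b) + (z m • layerNormal 1))}))
    {F : Measure (EuclideanSpace ℝ (Fin 3)) → ℝ≥0∞} (hF : Measurable F) (n : ℕ) :
    ∫⁻ μ, ((fun (h : EuclideanSpace ℝ (Fin 3) → ℝ≥0∞) (x : EuclideanSpace ℝ (Fin 3)) =>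
        (12 : ℝ≥0∞)⁻¹ * ∫⁻ y, ((fun y => y - x) ⁻¹'
          {v : EuclideanSpace ℝ (Fin 3) | 0 < dist (0 : EuclideanSpace ℝ (Fin 3)) v ∧
            dist (0 : EuclideanSpace ℝ (Fin 3)) v ≤ 28 / 25}).indicator h y ∂μ)^[n]
        (fun y => F (Measure.map (fun z => z - y) μ))) 0 ∂P
      = ∫⁻ μ, F μ ∂P := by
  have hBm : MeasurableSet {v : EuclideanSpace ℝ (Fin 3) | 0 < dist (0 : EuclideanSpace ℝ (Fin 3)) v ∧
      dist (0 : EuclideanSpace ℝ (Fin 3)) v ≤ 28 / 25} :=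
    (measurableSet_lt measurable_const (measurable_const.dist measurable_id)).inter
      (measurableSet_le (measurable_const.dist measurable_id) measurable_const)
  have hBsymm : ∀ y : EuclideanSpace ℝ (Fin 3),
      -y ∈ {v : EuclideanSpace ℝ (Fin 3) | 0 < dist (0 : EuclideanSpace ℝ (Fin 3)) v ∧
        dist (0 : EuclideanSpace ℝ (Fin 3)) v ≤ 28 / 25} ↔
      y ∈ {v : EuclideanSpace ℝ (Fin 3) | 0 < dist (0 : EuclideanSpace ℝ (Fin 3)) v ∧
        dist (0 : EuclideanSpace ℝ (Fin 3)) v ≤ 28 / 25} := by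
    intro y
    simp only [Set.mem_setOf_eq, dist_eq_norm, zero_sub, norm_neg]
  exact lintegral_confWalk_iterate hP (ae_floorNorm_lt_top_of_rooted hδ hroot) hBm hBsymm
    (by norm_num) (by norm_num) (ae_shell_eq_twelve_of_pattern hroot hpat) hF n

end Summit.AtomisticToContinuum.Crystallization.Theorems.ChartedPlanarOrderPatternWalkHyps
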